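/-
Copyright (c) 2026. All rights reserved.
Released under Apache 2.0 license as described in the file LICENSE.
Authors: abc-iut cell, prover seat abc-iut-L4-t5 (gen 9), over the genuine nonarchimedean settings of abc-iut-w4-d095 /
abc-iut-w5-d097 / abc-iut-w6-d028 lineages (`nonarchGenuine`, `nonarchGenuineMono`, `nonarchGenuineOver`, `nonarchGenuineSlim`).
-/
import Literature.AnabelianGeometry.AbsoluteAnabelian.LogFrobeniusObservablesTSOfIotaSquare
import Literature.AnabelianGeometry.AbsoluteAnabelian.LogFrobeniusNonarchGenuineOver
import HarnessLib

/-!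
# [AbsTopIII] Corollary 5.5 (iii), `TS`-half (FACT-LIST F-3080 `Cor55ObservablesTS`) HOLDS at the genuine NONARCHIMEDEAN carriers — for every `TS`-datum, in particular print's own

S. Mochizuki, *Topics in absolute anabelian geometry III: global reconstruction algorithms*,
J. Math. Sci. Univ. Tokyo 22 (2015) 939–1156 [MochizukiAbsTopIII2015]; locators `p.N` = pages of the author's
manuscript (`paper:url-5493eb38cbb7`): Def 5.4 (iii) p. 126 ("a commutative diagram": `𝒪^×_k̄ ↪ k̄^× → (k̄^×)^pf` versus
`𝒪^×_k̄ →(log) k~ ↪ (k̄^×)^pf`), (vii) p. 128, Cor 5.5 (iii) p. 131 (the observable `S_log`), (iv) p. 131.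

PROOF-ONLY companion (theorems only; nothing restated).  The observable `S_log` of Cor 5.5 (iii) — abc-iut-L4-t3's
`Cor55ObservablesTS` (F-3080), an ASSUMPTION on `(L, T)` refuted at degenerate data (abc-iut-w5-d097) and, before tonight,
witnessed in the tree only at the degenerate diagonal setting and (abc-iut-w5-d053, `LogFrobeniusObservablesTSOfPlus.lean`)
at the ARCHIMEDEAN places — EXISTS at the genuine NONARCHIMEDEAN carriers of the cell, for EVERY `TS`-datum `T` and in
particular for each carrier's own (print's) `TS`-datum: by `cor55ObservablesTS_of_iotaSquaresCommute` /
`cor55ObservablesTS_of_cor55Observables` (`LogFrobeniusObservablesTSOfIotaSquare.lean`: `S_log` exists wherever `S_log⊞`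
does) and the commuting printed square of Def 5.4 (iii) at the MLF model (`nonarchGenuine_iotaSquaresCommute`,
`nonarchGenuineOver_iotaSquaresCommute`, `nonarchGenuineMono_cor55Observables`, by name):

* `nonarchGenuine_cor55ObservablesTS (T)`, `nonarchGenuineMono_cor55ObservablesTS (T)`,
  `nonarchGenuineOver_cor55ObservablesTS (T)`, `nonarchGenuineSlim_cor55ObservablesTS (T)` — binders `{p, Vmod, isArc}`
  (`{C, ι}` over `ι`), ZERO hypotheses, every `T`;
* `nonarchGenuine_cor55iii_iv` & co. — at ONE carrier and its own `TS`-datum: `S_log⊞` (F-0142) ∧ `S_log` (F-3080) EXIST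
  ∧ the log-wall `Cor55LogWall` ∧ `Cor55NotSimultaneouslyCompatible` (Cor 5.5 (iv), sentences 1–2; abc-iut-w4-d095 /
  abc-iut-w6-d028 closers by name) — i.e. the `¬∃` of Cor 5.5 (iv) holds at a carrier where BOTH observable constituents
  it quantifies over are non-vacuous (the INFO item of the AbsTopIII:Cor5.5(iv) count-read 2026-08-27, nonarchimedean half;
  archimedean half: abc-iut-w5-d053 `archGenuine_cor55ObservablesTS`).

MODEL-LEVEL (module docstrings of the carriers: `ℰ•`, `An•`, the archimedean components are placeholders there).  Refereed
pre-IUT material; nothing here bears on [IUTchIII] Cor. 3.12; OUR kernel check, no side taken; non-vacuity ≠ endorsement.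
-/

set_option autoImplicit false

open CategoryTheory

namespace Literature.AnabelianGeometry.AbsoluteAnabelian

open AbsTopIII

namespace LogFrobeniusSetting

section Genuine

variable (p : ℕ) [Fact p.Prime] (Vmod : Type 1) (isArc : Vmod → Bool)

/-- **F-3080 HOLDS at the setting with genuine nonarchimedean components, for EVERY `TS`-datum.**
[cite: MochizukiAbsTopIII2015, Cor 5.5 (iii) p. 131] -/
theorem nonarchGenuine_cor55ObservablesTS (T : (nonarchGenuine p Vmod isArc).TSHomotopies) :
    (nonarchGenuine p Vmod isArc).Cor55ObservablesTS T :=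
  (nonarchGenuine p Vmod isArc).cor55ObservablesTS_of_iotaSquaresCommute T
    (nonarchGenuine_iotaSquaresCommute p Vmod isArc)

/-- … in particular for its own `TS`-datum (all six arrows of Def 5.4 (iii), `ι|_{Γ⃗^⋉} = ι⊞`).
[cite: MochizukiAbsTopIII2015, Cor 5.5 (iii) p. 131] -/
theorem nonarchGenuine_cor55ObservablesTS_self :
    (nonarchGenuine p Vmod isArc).Cor55ObservablesTS (nonarchGenuineTS p Vmod isArc) :=
  nonarchGenuine_cor55ObservablesTS p Vmod isArc _

/-- **F-3080 HOLDS at the genuine nonarchimedean setting with genuine mono-analytic side, for EVERY `TS`-datum.**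
[cite: MochizukiAbsTopIII2015, Cor 5.5 (iii) p. 131] -/
theorem nonarchGenuineMono_cor55ObservablesTS (T : (nonarchGenuineMono p Vmod isArc).TSHomotopies) :
    (nonarchGenuineMono p Vmod isArc).Cor55ObservablesTS T :=
  (nonarchGenuineMono p Vmod isArc).cor55ObservablesTS_of_cor55Observables T
    (nonarchGenuineMono_cor55Observables p Vmod isArc)

/-- … in particular for its own `TS`-datum. [cite: MochizukiAbsTopIII2015, Cor 5.5 (iii) p. 131] -/
theorem nonarchGenuineMono_cor55ObservablesTS_self :
    (nonarchGenuineMono p Vmod isArc).Cor55ObservablesTS (nonarchGenuineMonoTS p Vmod isArc) :=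
  nonarchGenuineMono_cor55ObservablesTS p Vmod isArc _

variable {C : Type 1} [Category.{1} C] (ι : C ⥤ TFModel p)

/-- **F-3080 HOLDS at the genuine nonarchimedean setting over `ι : C ⥤ TFModel p`, for EVERY `TS`-datum.**
[cite: MochizukiAbsTopIII2015, Cor 5.5 (iii) p. 131] -/
theorem nonarchGenuineOver_cor55ObservablesTS (T : (nonarchGenuineOver p ι Vmod isArc).TSHomotopies) :
    (nonarchGenuineOver p ι Vmod isArc).Cor55ObservablesTS T :=
  (nonarchGenuineOver p ι Vmod isArc).cor55ObservablesTS_of_iotaSquaresCommute T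
    (nonarchGenuineOver_iotaSquaresCommute p ι Vmod isArc)

/-- … in particular for its own `TS`-datum. [cite: MochizukiAbsTopIII2015, Cor 5.5 (iii) p. 131] -/
theorem nonarchGenuineOver_cor55ObservablesTS_self :
    (nonarchGenuineOver p ι Vmod isArc).Cor55ObservablesTS (nonarchGenuineOverTS p ι Vmod isArc) :=
  nonarchGenuineOver_cor55ObservablesTS p Vmod isArc ι _

/-- **F-3080 HOLDS at the SLIM genuine-nonarchimedean MLF carrier, for EVERY `TS`-datum.**
[cite: MochizukiAbsTopIII2015, Cor 5.5 (iii) p. 131] -/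
theorem nonarchGenuineSlim_cor55ObservablesTS (T : (nonarchGenuineSlim p Vmod isArc).TSHomotopies) :
    (nonarchGenuineSlim p Vmod isArc).Cor55ObservablesTS T :=
  nonarchGenuineOver_cor55ObservablesTS p Vmod isArc _ T

/-! ## Cor 5.5 (iii) ∧ (iv) at ONE carrier: the `¬∃` of (iv) with BOTH observable constituents non-vacuous -/

/-- **At the setting with genuine nonarchimedean components and its own `TS`-datum: `S_log⊞` (F-0142) and `S_log` (F-3080)
EXIST, and Cor 5.5 (iv)'s two sentences hold** (given a nonarchimedean place `v₀` and a model pair `x₀`; the (iv) half is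
abc-iut-w4-d095's `nonarchGenuine_cor55LogWall_and_notSimCompat`, by name). [cite: MochizukiAbsTopIII2015, Cor 5.5 (iv) p. 131] -/
theorem nonarchGenuine_cor55iii_iv (v₀ : Vmod) (hv₀ : isArc v₀ = false) (x₀ : Up (TFModel p)) :
    (nonarchGenuine p Vmod isArc).Cor55Observables ∧
      (nonarchGenuine p Vmod isArc).Cor55ObservablesTS (nonarchGenuineTS p Vmod isArc) ∧
      (nonarchGenuine p Vmod isArc).Cor55LogWall (nonarchGenuineTS p Vmod isArc) ∧
      (nonarchGenuine p Vmod isArc).Cor55NotSimultaneouslyCompatible (nonarchGenuineTS p Vmod isArc) :=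
  ⟨nonarchGenuine_cor55Observables p Vmod isArc, nonarchGenuine_cor55ObservablesTS_self p Vmod isArc,
    nonarchGenuine_cor55LogWall_and_notSimCompat p Vmod isArc v₀ hv₀ x₀⟩

/-- **The same at the genuine mono-analytic setting** (Cor 5.5 (iii) `⊞`/`TS` halves ∧ Cor 5.5 (iv) sentences 1–2; the (iv)
half is abc-iut-w6-d028's `nonarchGenuineMono_cor55LogWall_and_notSimCompat`). [cite: MochizukiAbsTopIII2015, Cor 5.5 (iv) p. 131] -/
theorem nonarchGenuineMono_cor55iii_iv (v₀ : Vmod) (hv₀ : isArc v₀ = false) (x₀ : Up (TFModel p)) :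
    (nonarchGenuineMono p Vmod isArc).Cor55Observables ∧
      (nonarchGenuineMono p Vmod isArc).Cor55ObservablesTS (nonarchGenuineMonoTS p Vmod isArc) ∧
      (nonarchGenuineMono p Vmod isArc).Cor55LogWall (nonarchGenuineMonoTS p Vmod isArc) ∧
      (nonarchGenuineMono p Vmod isArc).Cor55NotSimultaneouslyCompatible (nonarchGenuineMonoTS p Vmod isArc) :=
  ⟨nonarchGenuineMono_cor55Observables p Vmod isArc, nonarchGenuineMono_cor55ObservablesTS_self p Vmod isArc,
    nonarchGenuineMono_cor55LogWall_and_notSimCompat p Vmod isArc v₀ hv₀ x₀⟩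

/-- **The same at the SLIM carrier, with NO object binder** (the model pair discharged inside
`nonarchGenuineSlim_cor55LogWall_and_notSimCompat`): binders `{p, v₀ nonarchimedean}` only.
[cite: MochizukiAbsTopIII2015, Cor 5.5 (iv) p. 131] -/
theorem nonarchGenuineSlim_cor55iii_iv (v₀ : Vmod) (hv₀ : isArc v₀ = false) :
    (nonarchGenuineSlim p Vmod isArc).Cor55Observables ∧
      (nonarchGenuineSlim p Vmod isArc).Cor55ObservablesTS
          (nonarchGenuineOverTS p (ObjectProperty.ι _ : TFModel.Slim p ⥤ TFModel p) Vmod isArc) ∧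
      (nonarchGenuineSlim p Vmod isArc).Cor55LogWall
          (nonarchGenuineOverTS p (ObjectProperty.ι _ : TFModel.Slim p ⥤ TFModel p) Vmod isArc) ∧
      (nonarchGenuineSlim p Vmod isArc).Cor55NotSimultaneouslyCompatible
          (nonarchGenuineOverTS p (ObjectProperty.ι _ : TFModel.Slim p ⥤ TFModel p) Vmod isArc) :=
  ⟨nonarchGenuineOver_cor55Observables p _ Vmod isArc, nonarchGenuineOver_cor55ObservablesTS_self p Vmod isArc _,
    nonarchGenuineSlim_cor55LogWall_and_notSimCompat p Vmod isArc v₀ hv₀⟩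

include p in
/-- Existence form: over EVERY index set with a nonarchimedean place there is a setting CARRYING a `TS`-datum at which the
observables `S_log⊞`, `S_log` exist and both sentences of Cor 5.5 (iv) hold (data: a prime `p` only).
[cite: MochizukiAbsTopIII2015, Cor 5.5 (iv) p. 131] -/
theorem exists_setting_cor55iii_iv (v₀ : Vmod) (hv₀ : isArc v₀ = false) :
    ∃ (L : LogFrobeniusSetting Vmod isArc) (T : L.TSHomotopies),
      L.Cor55Observables ∧ L.Cor55ObservablesTS T ∧ L.Cor55LogWall T ∧ L.Cor55NotSimultaneouslyCompatible T :=
  ⟨_, _, nonarchGenuineSlim_cor55iii_iv p Vmod isArc v₀ hv₀⟩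

end Genuine

end LogFrobeniusSetting

end Literature.AnabelianGeometry.AbsoluteAnabelian
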